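import Mathlib.Analysis.InnerProductSpace.Basic
import Mathlib.Tactic
import HarnessLib

/-!
# Chords from a pole stay in a spherical shell

Elementary-geometry support file (everything proved; no definitions, no named facts) for the
gauge-gluing step of A. Waldron, Invent. math. 217 (2019), Lemma 3.5 / §4: exponential gauges
centred at the poles `±c` of the sphere `S_r` (`‖c‖ = r`) are controlled along CHORDS, and the
curvature hypothesis lives on the solid shell `r/4 ≤ ‖w‖ ≤ 2r`; we check that every chord from
`c` to a point `z` of the region `{r/2 ≤ ‖z‖ ≤ 7r/5, ⟨c, z⟩ ≥ −(3/10) r²}` (a thickened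
spherical cap of aperture `> 90°` around `c`, containing the equatorial band) stays in that shell:
`norm_chord_ge`, `norm_chord_le`, and the segment form `chord_mem_shell`.

References: A. Waldron, Invent. math. 217 (2019), §3–§4 [Waldron2019]; [folklore].
-/

noncomputable section

open Set
open scoped RealInnerProductSpace

namespace Literature.Analysis.InnerProduct

variable {E : Type*} [NormedAddCommGroup E] [InnerProductSpace ℝ E]

/-- Expansion of `‖c + τ(z − c)‖²`. [folklore] -/
theorem norm_sq_chord (c z : E) (τ : ℝ) :
    ‖c + τ • (z - c)‖ ^ 2 = (1 - τ) ^ 2 * ‖c‖ ^ 2 + 2 * τ * (1 - τ) * ⟪c, z⟫ + τ ^ 2 * ‖z‖ ^ 2 := by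
  have h : c + τ • (z - c) = (1 - τ) • c + τ • z := by
    rw [smul_sub, sub_smul, one_smul]; abel
  rw [h, @norm_add_sq_real, norm_smul, norm_smul, inner_smul_left, inner_smul_right, Real.norm_eq_abs,
    Real.norm_eq_abs, mul_pow, mul_pow, sq_abs, sq_abs]
  simp only [RCLike.conj_to_real]
  ring

/-- **Lower bound along chords from the pole**: for `‖c‖ = r`, `r/2 ≤ ‖z‖`, `⟨c, z⟩ ≥ −(3/10)r²`
and `τ ∈ [0, 1]`, `‖c + τ(z − c)‖ ≥ r/4`. [folklore] -/
theorem norm_chord_ge {c z : E} {r : ℝ} (hr : 0 < r) (hc : ‖c‖ = r) (hz : r / 2 ≤ ‖z‖)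
    (hcz : -(3 / 10) * r ^ 2 ≤ ⟪c, z⟫) {τ : ℝ} (hτ0 : 0 ≤ τ) (hτ1 : τ ≤ 1) :
    r / 4 ≤ ‖c + τ • (z - c)‖ := by
  have hsq : (r / 4) ^ 2 ≤ ‖c + τ • (z - c)‖ ^ 2 := by
    rw [norm_sq_chord, hc]
    have hz2 : (r / 2) ^ 2 ≤ ‖z‖ ^ 2 := pow_le_pow_left₀ (by positivity) hz 2
    have h1 : 0 ≤ 2 * τ * (1 - τ) := by nlinarith
    have h2 : 2 * τ * (1 - τ) * (-(3 / 10) * r ^ 2) ≤ 2 * τ * (1 - τ) * ⟪c, z⟫ :=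
      mul_le_mul_of_nonneg_left hcz h1
    have h3 : τ ^ 2 * (r / 2) ^ 2 ≤ τ ^ 2 * ‖z‖ ^ 2 := mul_le_mul_of_nonneg_left hz2 (sq_nonneg _)
    -- `q(τ) = (1−τ)² − (3/5)τ(1−τ) + τ²/4 ≥ 1/16`
    nlinarith [sq_nonneg (τ - 26 / 37), sq_nonneg r, mul_pos hr hr]
  exact (pow_le_pow_iff_left₀ (by positivity) (norm_nonneg _) two_ne_zero).1 hsq

/-- **Upper bound along chords**: for `‖c‖ = r`, `‖z‖ ≤ 7r/5`, `τ ∈ [0,1]`: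
`‖c + τ(z − c)‖ ≤ 2r`. [folklore] -/
theorem norm_chord_le {c z : E} {r : ℝ} (hr : 0 < r) (hc : ‖c‖ = r) (hz : ‖z‖ ≤ 7 / 5 * r)
    {τ : ℝ} (hτ0 : 0 ≤ τ) (hτ1 : τ ≤ 1) : ‖c + τ • (z - c)‖ ≤ 2 * r := by
  have h : c + τ • (z - c) = (1 - τ) • c + τ • z := by
    rw [smul_sub, sub_smul, one_smul]; abel
  rw [h]
  calc ‖(1 - τ) • c + τ • z‖ ≤ ‖(1 - τ) • c‖ + ‖τ • z‖ := norm_add_le _ _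
    _ = (1 - τ) * r + τ * ‖z‖ := by
        rw [norm_smul, norm_smul, Real.norm_eq_abs, Real.norm_eq_abs, abs_of_nonneg (by linarith),
          abs_of_nonneg hτ0, hc]
    _ ≤ (1 - τ) * r + τ * (7 / 5 * r) := by nlinarith
    _ ≤ 2 * r := by nlinarith

/-- **Chords from the pole stay in the shell** `r/4 ≤ ‖w‖ ≤ 2r`. [folklore] -/
theorem chord_mem_shell {c z : E} {r : ℝ} (hr : 0 < r) (hc : ‖c‖ = r) (hz1 : r / 2 ≤ ‖z‖)
    (hz2 : ‖z‖ ≤ 7 / 5 * r) (hcz : -(3 / 10) * r ^ 2 ≤ ⟪c, z⟫) {τ : ℝ} (hτ : τ ∈ Icc (0 : ℝ) 1) :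
    r / 4 ≤ ‖c + τ • (z - c)‖ ∧ ‖c + τ • (z - c)‖ ≤ 2 * r :=
  ⟨norm_chord_ge hr hc hz1 hcz hτ.1 hτ.2, norm_chord_le hr hc hz2 hτ.1 hτ.2⟩

/-- **Chords between points of the band**: for `‖z‖, ‖z'‖ ≥ 3r/4` with `⟨z, z'⟩ ≥ 0` (angle at
most `90°`), every point of the segment has norm `≥ r/2`. [folklore] -/
theorem norm_segment_ge_of_inner_nonneg {z z' : E} {r : ℝ} (hr : 0 < r) (hz : 3 / 4 * r ≤ ‖z‖)
    (hz' : 3 / 4 * r ≤ ‖z'‖) (hzz : 0 ≤ ⟪z, z'⟫) {τ : ℝ} (hτ0 : 0 ≤ τ) (hτ1 : τ ≤ 1) :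
    r / 2 ≤ ‖z + τ • (z' - z)‖ := by
  have hsq : (r / 2) ^ 2 ≤ ‖z + τ • (z' - z)‖ ^ 2 := by
    rw [norm_sq_chord]
    have hz2 : (3 / 4 * r) ^ 2 ≤ ‖z‖ ^ 2 := pow_le_pow_left₀ (by positivity) hz 2
    have hz2' : (3 / 4 * r) ^ 2 ≤ ‖z'‖ ^ 2 := pow_le_pow_left₀ (by positivity) hz' 2
    have h1 : 0 ≤ 2 * τ * (1 - τ) * ⟪z, z'⟫ := by
      have : 0 ≤ 2 * τ * (1 - τ) := by nlinarith
      exact mul_nonneg this hzz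
    have h2 : (1 - τ) ^ 2 * (3 / 4 * r) ^ 2 ≤ (1 - τ) ^ 2 * ‖z‖ ^ 2 :=
      mul_le_mul_of_nonneg_left hz2 (sq_nonneg _)
    have h3 : τ ^ 2 * (3 / 4 * r) ^ 2 ≤ τ ^ 2 * ‖z'‖ ^ 2 := mul_le_mul_of_nonneg_left hz2' (sq_nonneg _)
    -- `(9/16)((1−τ)² + τ²) r² ≥ (9/32) r² ≥ r²/4`
    nlinarith [sq_nonneg (τ - 1 / 2), sq_nonneg r]
  exact (pow_le_pow_iff_left₀ (by positivity) (norm_nonneg _) two_ne_zero).1 hsq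

/-- **Segments are bounded by their endpoints**: `‖z + τ(z' − z)‖ ≤ max ‖z‖ ‖z'‖`. [folklore] -/
theorem norm_segment_le_max (z z' : E) {τ : ℝ} (hτ0 : 0 ≤ τ) (hτ1 : τ ≤ 1) :
    ‖z + τ • (z' - z)‖ ≤ max ‖z‖ ‖z'‖ := by
  have h : z + τ • (z' - z) = (1 - τ) • z + τ • z' := by
    rw [smul_sub, sub_smul, one_smul]; abel
  rw [h]
  calc ‖(1 - τ) • z + τ • z'‖ ≤ ‖(1 - τ) • z‖ + ‖τ • z'‖ := norm_add_le _ _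
    _ = (1 - τ) * ‖z‖ + τ * ‖z'‖ := by
        rw [norm_smul, norm_smul, Real.norm_eq_abs, Real.norm_eq_abs, abs_of_nonneg (by linarith),
          abs_of_nonneg hτ0]
    _ ≤ (1 - τ) * max ‖z‖ ‖z'‖ + τ * max ‖z‖ ‖z'‖ :=
        add_le_add (mul_le_mul_of_nonneg_left (le_max_left _ _) (by linarith))
          (mul_le_mul_of_nonneg_left (le_max_right _ _) hτ0)
    _ = max ‖z‖ ‖z'‖ := by ring

/-- **Linear constraints are preserved along segments**: `⟨c, z + τ(z' − z)⟩ ≥ a` if both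
endpoints satisfy it. [folklore] -/
theorem inner_segment_ge {c z z' : E} {a τ : ℝ} (hz : a ≤ ⟪c, z⟫) (hz' : a ≤ ⟪c, z'⟫)
    (hτ0 : 0 ≤ τ) (hτ1 : τ ≤ 1) : a ≤ ⟪c, z + τ • (z' - z)⟫ := by
  rw [inner_add_right, inner_smul_right, inner_sub_right]
  nlinarith

end Literature.Analysis.InnerProduct
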